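import Summits.HodgeConjecture.HodgeConjecture.Theorems.F0P3CompactFactorActsTrivially   -- ★ (p04 g3): `Kc` acts trivially on a hol-type discrete `P` (:160)
import Summits.HodgeConjecture.HodgeConjecture.Theorems.F0P3ArchIsotypyConj               -- ★ B6c: the `P ↦ P̄` road (brings ★ `DiscreteAutomorphicRep.conj`, `isAntiholCotangentAt_iff_conj`, `rightRegular_conjL2`)
import Summits.HodgeConjecture.HodgeConjecture.Theorems.F0P3ClassTokensOfRecord            -- ★ p819048 (p04 g6): `Cls`, `cl`, `rep`, `rep_cl_areUnitarilyEquivalent`, `cl_eq_cl_iff`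
import HarnessLib

/-!
# Crux `H413` — rung 4, T5 v4 (RULING (V31)(ii)): the COMPACT-TRIVIALITY CLASS PREDICATE OF RECORD `cptTriv₀` and PIN (ix)
# «a cotangent `P` (holomorphic OR antiholomorphic type) has `cptTriv₀ (cl P)`»

Floor-0 programme P3 «U3-mult», seat F0P3-p02 (g6); crux item stmt-HodgeConjecture-24833 (`HCCMUnconditional.H413`); F0P3-plan (g4) RULING (V31) «COMPACT PLACES
SILENCED» (ii), REASSIGN 10:03:24Z (p04 (g6) closed), statement list 10:06Z.  In T5 v4 the kit carries a class predicate `cptTriv : Cls → Prop` («the compact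
archimedean factor `Kc = cmCompactFactor L ι H T hT` acts trivially on the class») with PIN (ix) «cotangent `P` ⇒ `cptTriv (cl P)`»; every class trace is weighted
by `[cptTriv c]` (the compact test component is silenced to `e_{Kc}`).  This file supplies the ED. 4 VALUE `cptTriv₀` (γ2 of (V31): `∀ k ∈ Kc, ∀ v ∈ (rep c).space,
R(k) v = v`, the action spelled exactly as ★ `F0P3CompactFactorActsTrivially` :126∕:160) together with the three facts the integrator needs: (G1) `Kc`-triviality is
invariant under UNITARY EQUIVALENCE of discrete automorphic representations (so `cptTriv₀ (cl P) ↔ Kc trivial on P`, although `rep (cl P)` is only unitarily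
equivalent to `P`); (G2) `Kc`-triviality passes between `P` and its complex conjugate `P̄` (★ `rightRegular_conjL2`: `R(k) f̄ = (R(k) f)‾`); and the ANTIHOLOMORPHIC
twin of ★ `cmCompactFactor_rightRegular_eq_self_of_isHolCotangentAt` — an antiholomorphic-type `P` has holomorphic-type conjugate `P̄` (★
`CotangentForms.isAntiholCotangentAt_iff_conj`, the road of ★ `F0P3ArchIsotypyConj` :292 for F1a), `Kc` acts trivially on `P̄` (★ :160), hence on `P` (G2).
DEF lane (`--kind definition`): ONE Prop-valued definition WITH BODY (`cptTriv₀`, the kit-field value the planner names; audit-tagged `vendored-fact` by shape only —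
it cites nothing and posits nothing) and theorems; no instance, no notation, no named fact, no `sorry`; kit-free (no `Lines` import, no T5-A import: `Gp L H` is
spelled `adelicGroupData L⁺ L c̄ 3 H`, its `abbrev` unfolding).

* §1 generic (`𝒢 : AdelicGroupData K`, `[IsAutomorphicMeasure μ]`, `Kc : Subgroup 𝒢.Adelic`): `forall_rightRegular_eq_self_of_areUnitarilyEquivalent` (G1),
  `forall_rightRegular_eq_self_iff_of_areUnitarilyEquivalent`, `forall_rightRegular_eq_self_of_conj`, `forall_rightRegular_eq_self_conj_iff` (G2).
* §2 CM frame of H413 (binders of ★ :160): `cmCompactFactor_rightRegular_eq_self_of_isAntiholCotangentAt`, `…_of_isHolOrAntihol`.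
* §3 `cptTriv₀` + `cptTriv₀_iff` (rfl), `cptTriv₀_cl_iff`, `cptTriv₀_congr`, PIN (ix) `cptTriv₀_cl_of_isHolOrAntihol` (+ `_of_isHolCotangentAt`, `_of_isAntiholCotangentAt`).
HONEST LABEL: HC_CM is proved only modulo the printed citations until rung 0 closes; this file discharges none of them.
References: Rogawski (1990) §14.6 p. 244, §15.3 ¶1 [Rogawski1990]; Borel–Jacquet (1979) §4.6 [BorelJacquet1979]; Dixmier (1977) §13.1.3, §13.1.5 [Dixmier1977];
Getz–Hahn (2024) Thm. 6.5.2 [GetzHahn2024].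
-/

set_option autoImplicit false
-- the mandated namespace repeats `HodgeConjecture.HodgeConjecture`, as in every `Theorems/*.lean` of this sub-problem
set_option linter.dupNamespace false

noncomputable section

namespace Summit.HodgeConjecture.HodgeConjecture.Cruxes.H413.F0P3CompactTrivOfRecord

open MeasureTheory NumberField
open Literature.NumberTheory.Automorphic Literature.NumberTheory.Automorphic.UnitaryGroup
open Literature.NumberTheory.Automorphic.UnitaryGroup.CotangentForms (cmArchSection cmCompactFactor)
open ContRepresentation (AreUnitarilyEquivalent ClosedSubrep)
open Summit.HodgeConjecture.HodgeConjecture.Cruxes.H413.F0P3ClassTokensOfRecord (Cls cl rep rep_cl_areUnitarilyEquivalent cl_eq_cl_iff)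

universe u

/-! ## §1 Generic: `Kc`-triviality along unitary equivalence and along complex conjugation -/

section Generic

variable {K : Type} [Field K] [NumberField K] {𝒢 : AdelicGroupData.{u} K} {μ : Measure 𝒢.automorphicQuotient} [𝒢.IsAutomorphicMeasure μ]

/-- **(G1) `Kc`-triviality is invariant under unitary equivalence**: if `P ≃ P′` unitarily (★ `AreUnitarilyEquivalent` of the closed invariant subspaces of
`L²`) and every `k ∈ Kc` fixes `P` pointwise, then every `k ∈ Kc` fixes `P′` pointwise (the equivalence intertwines `R(k)`; action spelled as ★
`F0P3CompactFactorActsTrivially` :126). [cite: Dixmier1977, §13.1.3] -/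
theorem forall_rightRegular_eq_self_of_areUnitarilyEquivalent {P P' : DiscreteAutomorphicRep 𝒢 μ}
    (h : AreUnitarilyEquivalent P.space.toContRep P'.space.toContRep) (Kc : Subgroup 𝒢.Adelic)
    (hP : ∀ k : 𝒢.Adelic, k ∈ Kc → ∀ v : P.space.toSubmodule, 𝒢.rightRegular μ k (v : 𝒢.L2 μ) = v) :
    ∀ k : 𝒢.Adelic, k ∈ Kc → ∀ v : P'.space.toSubmodule, 𝒢.rightRegular μ k (v : 𝒢.L2 μ) = v := by
  obtain ⟨e, -⟩ := h
  intro k hk v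
  -- `f = e⁻¹ : P′ → P` intertwines `R(k)`; `R(k)` fixes `f v`, hence `f (R(k) v) = f v`, and `f` is injective
  have h1 : P.space.toContRep k (e.symm.toContinuousLinearEquiv.toContinuousLinearMap v) =
      e.symm.toContinuousLinearEquiv.toContinuousLinearMap v :=
    Subtype.ext (by rw [ClosedSubrep.coe_toContRep_apply]; exact hP k hk _)
  have h2 : e.symm.toContinuousLinearEquiv.toContinuousLinearMap (P'.space.toContRep k v) =
      P.space.toContRep k (e.symm.toContinuousLinearEquiv.toContinuousLinearMap v) :=
    DFunLike.congr_fun (e.symm.isIntertwining k) v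
  rw [h1] at h2
  have h3 : P'.space.toContRep k v = v := e.symm.toContinuousLinearEquiv.injective h2
  have h4 := congrArg Subtype.val h3
  rwa [ClosedSubrep.coe_toContRep_apply] at h4

/-- `Kc`-triviality is a property of the unitary equivalence class. [cite: Dixmier1977, §13.1.3] -/
theorem forall_rightRegular_eq_self_iff_of_areUnitarilyEquivalent {P P' : DiscreteAutomorphicRep 𝒢 μ}
    (h : AreUnitarilyEquivalent P.space.toContRep P'.space.toContRep) (Kc : Subgroup 𝒢.Adelic) :
    (∀ k : 𝒢.Adelic, k ∈ Kc → ∀ v : P.space.toSubmodule, 𝒢.rightRegular μ k (v : 𝒢.L2 μ) = v) ↔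
      ∀ k : 𝒢.Adelic, k ∈ Kc → ∀ v : P'.space.toSubmodule, 𝒢.rightRegular μ k (v : 𝒢.L2 μ) = v :=
  ⟨forall_rightRegular_eq_self_of_areUnitarilyEquivalent h Kc, forall_rightRegular_eq_self_of_areUnitarilyEquivalent h.symm Kc⟩

/-- **(G2) `Kc`-triviality descends from the complex conjugate `P̄` to `P`**: `R(k) f̄ = (R(k) f)‾` (★ `rightRegular_conjL2`) and `f ↦ f̄` is injective.
[cite: BorelJacquet1979, §4.6] -/
theorem forall_rightRegular_eq_self_of_conj (P : DiscreteAutomorphicRep 𝒢 μ) (Kc : Subgroup 𝒢.Adelic)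
    (h : ∀ k : 𝒢.Adelic, k ∈ Kc → ∀ w : P.conj.space.toSubmodule, 𝒢.rightRegular μ k (w : 𝒢.L2 μ) = w) :
    ∀ k : 𝒢.Adelic, k ∈ Kc → ∀ v : P.space.toSubmodule, 𝒢.rightRegular μ k (v : 𝒢.L2 μ) = v := by
  intro k hk v
  have hw : 𝒢.rightRegular μ k (𝒢.conjL2 μ (v : 𝒢.L2 μ)) = 𝒢.conjL2 μ (v : 𝒢.L2 μ) :=
    h k hk ⟨star (v : 𝒢.L2 μ), P.star_mem_conj_space v.2⟩
  rw [AdelicGroupData.rightRegular_conjL2] at hw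
  exact (𝒢.conjL2 μ).injective hw

/-- **(G2, iff)**: `Kc` acts trivially on `P̄` iff it acts trivially on `P` (`P̄̄ = P`, ★ `DiscreteAutomorphicRep.conj_conj`). [cite: BorelJacquet1979, §4.6] -/
theorem forall_rightRegular_eq_self_conj_iff (P : DiscreteAutomorphicRep 𝒢 μ) (Kc : Subgroup 𝒢.Adelic) :
    (∀ k : 𝒢.Adelic, k ∈ Kc → ∀ w : P.conj.space.toSubmodule, 𝒢.rightRegular μ k (w : 𝒢.L2 μ) = w) ↔
      ∀ k : 𝒢.Adelic, k ∈ Kc → ∀ v : P.space.toSubmodule, 𝒢.rightRegular μ k (v : 𝒢.L2 μ) = v := by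
  refine ⟨forall_rightRegular_eq_self_of_conj P Kc, fun h => forall_rightRegular_eq_self_of_conj P.conj Kc ?_⟩
  rw [DiscreteAutomorphicRep.conj_conj]
  exact h

end Generic

/-! ## §2 The CM frame of H413: `cmCompactFactor` acts trivially on an ANTIHOLOMORPHIC-type discrete `P` -/

section CM

open scoped Matrix ComplexOrder

variable (L : Type) [Field L] [NumberField L] [IsCMField L] (ι : L →+* ℂ) (H : Matrix (Fin 3) (Fin 3) L) (T : GL (Fin 3) ℂ)
  (hT : (T : Matrix (Fin 3) (Fin 3) ℂ)ᴴ * H.map ι * (T : Matrix (Fin 3) (Fin 3) ℂ) = Literature.Geometry.ComplexHyperbolic.BallModel.J)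
  {μ : Measure (adelicGroupData (↥(maximalRealSubfield L)) L (IsCMField.complexConj L) 3 H).automorphicQuotient}
  [(adelicGroupData (↥(maximalRealSubfield L)) L (IsCMField.complexConj L) 3 H).IsAutomorphicMeasure μ]

/-- **On a `(0,1)`-type (antiholomorphic cotangent) discrete `P` of `U(H)` the compact archimedean factor `cmCompactFactor L ι H T hT` acts trivially** — the
ANTIHOL twin of ★ `cmCompactFactor_rightRegular_eq_self_of_isHolCotangentAt`: `P̄` is of `(1,0)`-type (★ `isAntiholCotangentAt_iff_conj`), `Kc` fixes `P̄` pointwise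
(★ :160), hence `P` (§1 (G2)). [cite: Rogawski1990, §15.3 ¶1] [cite: BorelJacquet1979, §4.6] -/
theorem cmCompactFactor_rightRegular_eq_self_of_isAntiholCotangentAt
    (P : DiscreteAutomorphicRep (adelicGroupData (↥(maximalRealSubfield L)) L (IsCMField.complexConj L) 3 H) μ)
    (hP : P.IsAntiholCotangentAt (cmArchSection L ι H T hT) (cmCompactFactor L ι H T hT))
    (k : (adelicGroupData (↥(maximalRealSubfield L)) L (IsCMField.complexConj L) 3 H).Adelic) (hk : k ∈ cmCompactFactor L ι H T hT)
    (v : P.space.toSubmodule) :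
    (adelicGroupData (↥(maximalRealSubfield L)) L (IsCMField.complexConj L) 3 H).rightRegular μ k
      (v : (adelicGroupData (↥(maximalRealSubfield L)) L (IsCMField.complexConj L) 3 H).L2 μ) = v :=
  forall_rightRegular_eq_self_of_conj P (cmCompactFactor L ι H T hT)
    (fun k hk w => F0P3CompactFactorActsTrivially.cmCompactFactor_rightRegular_eq_self_of_isHolCotangentAt L ι H T hT P.conj
      ((CotangentForms.isAntiholCotangentAt_iff_conj P (cmArchSection L ι H T hT) (cmCompactFactor L ι H T hT)).mp hP) k hk w) k hk v

/-- **`cmCompactFactor` acts trivially on every COTANGENT discrete `P`** (holomorphic OR antiholomorphic type — the v4 head's frame predicate, RULING (V30)(1)).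
[cite: Rogawski1990, §15.3 ¶1] [cite: BorelJacquet1979, §4.6] -/
theorem cmCompactFactor_rightRegular_eq_self_of_isHolOrAntihol
    (P : DiscreteAutomorphicRep (adelicGroupData (↥(maximalRealSubfield L)) L (IsCMField.complexConj L) 3 H) μ)
    (hP : P.IsHolCotangentAt (cmArchSection L ι H T hT) (cmCompactFactor L ι H T hT) ∨
      P.IsAntiholCotangentAt (cmArchSection L ι H T hT) (cmCompactFactor L ι H T hT))
    (k : (adelicGroupData (↥(maximalRealSubfield L)) L (IsCMField.complexConj L) 3 H).Adelic) (hk : k ∈ cmCompactFactor L ι H T hT)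
    (v : P.space.toSubmodule) :
    (adelicGroupData (↥(maximalRealSubfield L)) L (IsCMField.complexConj L) 3 H).rightRegular μ k
      (v : (adelicGroupData (↥(maximalRealSubfield L)) L (IsCMField.complexConj L) 3 H).L2 μ) = v := by
  rcases hP with hP | hP
  · exact F0P3CompactFactorActsTrivially.cmCompactFactor_rightRegular_eq_self_of_isHolCotangentAt L ι H T hT P hP k hk v
  · exact cmCompactFactor_rightRegular_eq_self_of_isAntiholCotangentAt L ι H T hT P hP k hk v

/-! ## §3 The class predicate of record `cptTriv₀` and PIN (ix) -/

variable (μ)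

/-- **`cptTriv₀ c` — THE COMPACT-TRIVIALITY PREDICATE OF RECORD** (RULING (V31)(ii), value γ2): the compact archimedean factor `Kc = cmCompactFactor L ι H T hT`
acts trivially on (the chosen representative ★ `rep` of) the class `c` — `∀ k ∈ Kc, ∀ v ∈ (rep c).space, R(k) v = v`, the action spelled exactly as ★
`F0P3CompactFactorActsTrivially` :126∕:160.  By (G1) this does not depend on the representative (`cptTriv₀_cl_iff`).  In print: inside every non-empty
ξ-fibre the compact coordinate of `π′` is the trivial representation of `Kc` [Rogawski1990 §14.6 p. 244]. [cite: Rogawski1990, §14.6 p. 244] [cite: Dixmier1977, §13.1.3] -/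
def cptTriv₀ (c : Cls (adelicGroupData (↥(maximalRealSubfield L)) L (IsCMField.complexConj L) 3 H) μ) : Prop :=
  ∀ k : (adelicGroupData (↥(maximalRealSubfield L)) L (IsCMField.complexConj L) 3 H).Adelic, k ∈ cmCompactFactor L ι H T hT →
    ∀ v : (rep (adelicGroupData (↥(maximalRealSubfield L)) L (IsCMField.complexConj L) 3 H) μ c).space.toSubmodule,
      (adelicGroupData (↥(maximalRealSubfield L)) L (IsCMField.complexConj L) 3 H).rightRegular μ k
        (v : (adelicGroupData (↥(maximalRealSubfield L)) L (IsCMField.complexConj L) 3 H).L2 μ) = v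

/-- Unfolding `cptTriv₀` (definitional). [cite: Dixmier1977, §13.1.3] -/
theorem cptTriv₀_iff (c : Cls (adelicGroupData (↥(maximalRealSubfield L)) L (IsCMField.complexConj L) 3 H) μ) :
    cptTriv₀ L ι H T hT μ c ↔
      ∀ k : (adelicGroupData (↥(maximalRealSubfield L)) L (IsCMField.complexConj L) 3 H).Adelic, k ∈ cmCompactFactor L ι H T hT →
        ∀ v : (rep (adelicGroupData (↥(maximalRealSubfield L)) L (IsCMField.complexConj L) 3 H) μ c).space.toSubmodule,
          (adelicGroupData (↥(maximalRealSubfield L)) L (IsCMField.complexConj L) 3 H).rightRegular μ k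
            (v : (adelicGroupData (↥(maximalRealSubfield L)) L (IsCMField.complexConj L) 3 H).L2 μ) = v :=
  Iff.rfl

/-- **`cptTriv₀ (cl P) ↔ Kc` acts trivially on `P` itself** (`rep (cl P) ≃ P` unitarily, ★ `rep_cl_areUnitarilyEquivalent`, and (G1) both ways).
[cite: Dixmier1977, §13.1.3] [cite: Rogawski1990, §14.6 p. 244] -/
theorem cptTriv₀_cl_iff (P : DiscreteAutomorphicRep (adelicGroupData (↥(maximalRealSubfield L)) L (IsCMField.complexConj L) 3 H) μ) :
    cptTriv₀ L ι H T hT μ (cl (adelicGroupData (↥(maximalRealSubfield L)) L (IsCMField.complexConj L) 3 H) μ P) ↔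
      ∀ k : (adelicGroupData (↥(maximalRealSubfield L)) L (IsCMField.complexConj L) 3 H).Adelic, k ∈ cmCompactFactor L ι H T hT →
        ∀ v : P.space.toSubmodule,
          (adelicGroupData (↥(maximalRealSubfield L)) L (IsCMField.complexConj L) 3 H).rightRegular μ k
            (v : (adelicGroupData (↥(maximalRealSubfield L)) L (IsCMField.complexConj L) 3 H).L2 μ) = v :=
  forall_rightRegular_eq_self_iff_of_areUnitarilyEquivalent
    (rep_cl_areUnitarilyEquivalent (adelicGroupData (↥(maximalRealSubfield L)) L (IsCMField.complexConj L) 3 H) μ P) (cmCompactFactor L ι H T hT)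

/-- **`cptTriv₀ ∘ cl` is invariant under unitary equivalence** (indeed `cl P = cl P′`, ★ `cl_eq_cl_iff`) — the form in which (G1) is consumed at `𝔠₀`.
[cite: Dixmier1977, §13.1.3] -/
theorem cptTriv₀_congr {P P' : DiscreteAutomorphicRep (adelicGroupData (↥(maximalRealSubfield L)) L (IsCMField.complexConj L) 3 H) μ}
    (h : AreUnitarilyEquivalent P.space.toContRep P'.space.toContRep) :
    cptTriv₀ L ι H T hT μ (cl (adelicGroupData (↥(maximalRealSubfield L)) L (IsCMField.complexConj L) 3 H) μ P) ↔
      cptTriv₀ L ι H T hT μ (cl (adelicGroupData (↥(maximalRealSubfield L)) L (IsCMField.complexConj L) 3 H) μ P') := by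
  rw [(cl_eq_cl_iff (adelicGroupData (↥(maximalRealSubfield L)) L (IsCMField.complexConj L) 3 H) μ P P').2 h]

/-- **PIN (ix) — a COTANGENT `P` (holomorphic or antiholomorphic type at `ι`) has `cptTriv₀ (cl P)`** (§2 + `cptTriv₀_cl_iff`).
[cite: Rogawski1990, §14.6 p. 244; §15.3 ¶1] [cite: BorelJacquet1979, §4.6] -/
theorem cptTriv₀_cl_of_isHolOrAntihol (P : DiscreteAutomorphicRep (adelicGroupData (↥(maximalRealSubfield L)) L (IsCMField.complexConj L) 3 H) μ)
    (hP : P.IsHolCotangentAt (cmArchSection L ι H T hT) (cmCompactFactor L ι H T hT) ∨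
      P.IsAntiholCotangentAt (cmArchSection L ι H T hT) (cmCompactFactor L ι H T hT)) :
    cptTriv₀ L ι H T hT μ (cl (adelicGroupData (↥(maximalRealSubfield L)) L (IsCMField.complexConj L) 3 H) μ P) :=
  (cptTriv₀_cl_iff L ι H T hT μ P).2 (cmCompactFactor_rightRegular_eq_self_of_isHolOrAntihol L ι H T hT P hP)

/-- PIN (ix), holomorphic case. [cite: Rogawski1990, §15.3 ¶1] -/
theorem cptTriv₀_cl_of_isHolCotangentAt (P : DiscreteAutomorphicRep (adelicGroupData (↥(maximalRealSubfield L)) L (IsCMField.complexConj L) 3 H) μ)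
    (hP : P.IsHolCotangentAt (cmArchSection L ι H T hT) (cmCompactFactor L ι H T hT)) :
    cptTriv₀ L ι H T hT μ (cl (adelicGroupData (↥(maximalRealSubfield L)) L (IsCMField.complexConj L) 3 H) μ P) :=
  cptTriv₀_cl_of_isHolOrAntihol L ι H T hT μ P (Or.inl hP)

/-- PIN (ix), antiholomorphic case. [cite: Rogawski1990, §15.3 ¶1] [cite: BorelJacquet1979, §4.6] -/
theorem cptTriv₀_cl_of_isAntiholCotangentAt (P : DiscreteAutomorphicRep (adelicGroupData (↥(maximalRealSubfield L)) L (IsCMField.complexConj L) 3 H) μ)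
    (hP : P.IsAntiholCotangentAt (cmArchSection L ι H T hT) (cmCompactFactor L ι H T hT)) :
    cptTriv₀ L ι H T hT μ (cl (adelicGroupData (↥(maximalRealSubfield L)) L (IsCMField.complexConj L) 3 H) μ P) :=
  cptTriv₀_cl_of_isHolOrAntihol L ι H T hT μ P (Or.inr hP)

end CM

end Summit.HodgeConjecture.HodgeConjecture.Cruxes.H413.F0P3CompactTrivOfRecord

end
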